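import Literature.Topology.FourManifolds.SmoothEmbeddingCriteria
import HarnessLib

/-!
# Transport of a compactly supported diffeomorphism along an open smooth embedding

Topic `Literature/Topology/FourManifolds`; the manifold-with-boundary form of
`exists_diffeomorph_chartTransport` (`ChartTransport.lean`, where the open piece is a chart
onto a whole vector space).  Let `e : U → M` be an open smooth embedding between manifolds over
the same model with corners (e.g. Kosinski's attaching map `h̄ : T → M` of a handle, an open
embedding of manifolds with boundary), and let `ξ` be a self-diffeomorphism of `U` which is the
identity off a compact set `K ⊆ U`.  Then **`e ∘ ξ ∘ e⁻¹`, extended by the identity, is a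
self-diffeomorphism `Ξ` of `M`** with `Ξ ∘ e = e ∘ ξ` and `Ξ = id` off `e(K)`
(`exists_diffeomorph_transport_of_isOpenEmbedding`).  The underlying map is Mathlib's
`Function.extend e (e ∘ ξ) id`.  This is the static form of the remark that a compactly
supported diffeotopy of an open subset extends by the identity (Hirsch, *Differential Topology*
(1976), Ch. 8 §1, Thms. 1.3–1.4 and proof of Thm. 3.2); it carries the straightening
diffeomorphism of the tube `T` produced in the model over to the manifold in the uniqueness of
the tube germ of a handle attaching map (roadmap of `PresentationHandlebodyFiveProofs.lean`;
Kosinski, *Differential Manifolds* (1993), VI §5).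

Everything here is proved; no definitions, no named facts.

## References

* M. W. Hirsch, *Differential Topology*, GTM 33 (1976), Ch. 8 §1, Thms. 1.3–1.4. [HirschDT1976]
* A. A. Kosinski, *Differential Manifolds*, Academic Press (1993), VI §5. [Kosinski1993]
-/

noncomputable section

open Set Function Topology

open scoped Manifold ContDiff Topology

namespace Literature.Topology.FourManifolds

universe u v

variable {E : Type*} [NormedAddCommGroup E] [NormedSpace ℝ E] {H : Type*} [TopologicalSpace H]
  {I : ModelWithCorners ℝ E H}
  {U : Type u} [TopologicalSpace U] [ChartedSpace H U]
  {M : Type v} [TopologicalSpace M] [ChartedSpace H M]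

omit [TopologicalSpace U] [ChartedSpace H U] [TopologicalSpace M] [ChartedSpace H M] in
/-- **Support**: if `s = id` off `K`, the transport `e ∘ s ∘ e⁻¹ ∪ id = Function.extend e (e ∘ s) id`
of `s` along an injective `e` is the identity off `e(K)`. [folklore] -/
theorem extend_comp_eq_self_of_not_mem_image {e : U → M} (he : Injective e) {s : U → U}
    {K : Set U} (hs : ∀ y, y ∉ K → s y = y) {x : M} (hx : x ∉ e '' K) :
    Function.extend e (e ∘ s) id x = x := by
  by_cases hxr : ∃ y, e y = x
  · obtain ⟨y, rfl⟩ := hxr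
    rw [he.extend_apply, comp_apply, hs y fun hy => hx ⟨y, hy, rfl⟩]
  · exact Function.extend_apply' _ _ _ hxr

omit [TopologicalSpace U] [ChartedSpace H U] [TopologicalSpace M] [ChartedSpace H M] in
/-- Transports of maps inverse to each other are inverse to each other. [folklore] -/
theorem extend_comp_extend_comp {e : U → M} (he : Injective e) {s t : U → U}
    (hst : ∀ y, t (s y) = y) (x : M) :
    Function.extend e (e ∘ t) id (Function.extend e (e ∘ s) id x) = x := by
  by_cases hxr : ∃ y, e y = x
  · obtain ⟨y, rfl⟩ := hxr
    rw [he.extend_apply, comp_apply, he.extend_apply, comp_apply, hst]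
  · rw [Function.extend_apply' _ _ _ hxr, id, Function.extend_apply' _ _ _ hxr, id]

variable [T2Space M]

/-- **The transport of a compactly supported smooth self-map along an open smooth embedding is
smooth**: near the range it is `e ∘ s ∘ e⁻¹` (the inverse of an open smooth embedding is smooth
on the range, `contMDiffOn_symm_of_isSmoothEmbedding`), near the closed set `M ∖ e(K)` it is
the identity. [folklore] -/
theorem contMDiff_extend_comp {e : U → M} (hsm : Manifold.IsSmoothEmbedding I I ∞ e)
    (he : IsOpenEmbedding e) {s : U → U} (hs : ContMDiff I I ∞ s) {K : Set U} (hK : IsCompact K)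
    (hsK : ∀ y, y ∉ K → s y = y) : ContMDiff I I ∞ (Function.extend e (e ∘ s) id) := by
  intro x
  by_cases hxr : x ∈ range e
  · haveI : Nonempty U := by obtain ⟨y, -⟩ := hxr; exact ⟨y⟩
    have hev : Function.extend e (e ∘ s) id =ᶠ[𝓝 x]
        fun z => e (s ((he.toOpenPartialHomeomorph e).symm z)) := by
      filter_upwards [he.isOpen_range.mem_nhds hxr] with z hz
      obtain ⟨y, rfl⟩ := hz
      rw [he.injective.extend_apply, comp_apply, he.toOpenPartialHomeomorph_left_inv]
    refine ContMDiffAt.congr_of_eventuallyEq ?_ hev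
    have h1 : ContMDiffAt I I ∞ (he.toOpenPartialHomeomorph e).symm x :=
      (contMDiffOn_symm_of_isSmoothEmbedding hsm he).contMDiffAt (he.isOpen_range.mem_nhds hxr)
    exact hsm.contMDiff.contMDiffAt.comp x (hs.contMDiffAt.comp x h1)
  · have hclosed : IsClosed (e '' K) := (hK.image he.continuous).isClosed
    have hxK : x ∉ e '' K := fun ⟨y, _, hy⟩ => hxr ⟨y, hy⟩
    have hev : Function.extend e (e ∘ s) id =ᶠ[𝓝 x] id := by
      filter_upwards [hclosed.isOpen_compl.mem_nhds hxK] with z hz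
      exact extend_comp_eq_self_of_not_mem_image he.injective hsK hz
    exact contMDiffAt_id.congr_of_eventuallyEq hev

/-- **Transport of a compactly supported diffeomorphism along an open smooth embedding.**  Let
`e : U → M` be an open smooth embedding (same model with corners on both sides, `M` Hausdorff)
and `ξ` a self-diffeomorphism of `U` equal to the identity off a compact set `K`.  Then there is a
self-diffeomorphism `Ξ` of `M` with `Ξ (e y) = e (ξ y)` for all `y` and `Ξ x = x` off `e(K)`
(namely `Function.extend e (e ∘ ξ) id`, i.e. `e ∘ ξ ∘ e⁻¹` extended by the identity).  Hirsch
(1976), Ch. 8 §1 (extension by the identity of compactly supported diffeotopies of open subsets).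
[cite: HirschDT1976, Ch. 8 §1, Thm. 1.3] -/
theorem exists_diffeomorph_transport_of_isOpenEmbedding {e : U → M}
    (hsm : Manifold.IsSmoothEmbedding I I ∞ e) (ho : IsOpen (range e)) (ξ : U ≃ₘ⟮I, I⟯ U)
    {K : Set U} (hK : IsCompact K) (hξ : ∀ y, y ∉ K → ξ y = y) :
    ∃ Ξ : M ≃ₘ⟮I, I⟯ M, (∀ y, Ξ (e y) = e (ξ y)) ∧ ∀ x, x ∉ e '' K → Ξ x = x := by
  have he : IsOpenEmbedding e := ⟨hsm.isEmbedding, ho⟩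
  have hξ' : ∀ y, y ∉ K → ξ.symm y = y := fun y hy => by
    conv_lhs => rw [← hξ y hy]
    exact ξ.symm_apply_apply y
  let Ξ : M ≃ₘ⟮I, I⟯ M :=
    { toFun := Function.extend e (e ∘ ξ) id
      invFun := Function.extend e (e ∘ ξ.symm) id
      left_inv := extend_comp_extend_comp he.injective ξ.symm_apply_apply
      right_inv := extend_comp_extend_comp he.injective ξ.apply_symm_apply
      contMDiff_toFun := contMDiff_extend_comp hsm he ξ.contMDiff hK hξ
      contMDiff_invFun := contMDiff_extend_comp hsm he ξ.symm.contMDiff hK hξ' }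
  exact ⟨Ξ, fun y => he.injective.extend_apply _ _ y,
    fun x hx => extend_comp_eq_self_of_not_mem_image he.injective hξ hx⟩

end Literature.Topology.FourManifolds

end
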